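import Mathlib
import HarnessLib

/-!
# Kronecker modules I: chains (polynomial solutions of a pencil) and the dimension count

Cell `pub-omega` (unit `pub-omega-tensor-g33`), topic `Summits/MatrixMultiplication/OmegaCensus` (sub-folder `SmallFormats`).
Framing (verbatim): lottery ticket; floor = certified bounds/negative ranges. HONEST FRAMING: general linear algebra
(Weierstraß–Kronecker theory of a pencil = two linear maps `a b : U →ₗ[k] V` over a field), first file of the lane that
PROVES the hypothesis `KroneckerBlockForm97` of `MatMul227GF3FootprintBlockForm` (tensor g32, p642513). Nothing on `ω` here.

A *Kronecker module* is a pair of linear maps `a b : U →ₗ[k] V` (a matrix pencil `A + λB` read basis-free: rows = a basis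
of `U`, columns = a basis of `V`). An *I-chain of length `m`* (`IsChain a b m x`) is a sequence `x : ℕ → U`, supported on
`{0,…,m}`, with `a (x 0) = 0` and `a (x (t+1)) = b (x t)` for all `t` — i.e. a polynomial solution `Σ xₜ λᵗ` of degree `≤ m`
of the row equation of the pencil; a nonzero chain of minimal length spans a Kronecker block `L_mᵀ` (Gantmacher, *Theory of
matrices* II, ch. XII §3, in module language). `IsOpenPath` drops the head condition. `ChainFree a b` says there is no
nonzero chain. Main results: chains restrict/extend along invariant subspace pairs (`restr`), a nonzero chain exists as soon
as `finrank V < finrank U` (`exists_chain_of_finrank_lt`, kernel of an explicit linear map between `Fin`-powers), hence a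
chain-free module has `finrank U ≤ finrank V` on every invariant pair (`ChainFree.finrank_le`), and a non-chain-free module
has a MINIMAL nonzero chain (`exists_minimal_chain`) whose end terms are nonzero.
-/

namespace Summit.MatrixMultiplication.OmegaCensus.SmallFormats.Kronecker

open Module

variable {k : Type*} [Field k] {U V : Type*} [AddCommGroup U] [Module k U] [AddCommGroup V] [Module k V]

/-! ## Sequences -/

/-- Prepend an element to a sequence: `prepend u p 0 = u`, `prepend u p (t+1) = p t`. -/
def prepend {α : Type*} (u : α) (p : ℕ → α) : ℕ → α
  | 0 => u
  | t + 1 => p t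

/-- `prepend u p 0 = u`. -/
@[simp] theorem prepend_zero {α : Type*} (u : α) (p : ℕ → α) : prepend u p 0 = u := rfl

/-- `prepend u p (t+1) = p t`. -/
@[simp] theorem prepend_succ {α : Type*} (u : α) (p : ℕ → α) (t : ℕ) : prepend u p (t + 1) = p t := rfl

/-! ## Open paths and chains -/

/-- An *open path of length `j`*: a sequence `p : ℕ → U` supported on `t < j` with `a (p (t+1)) = b (p t)` for all `t`
(so `b (p (j-1)) = 0`; no condition on `a (p 0)`). -/
structure IsOpenPath (a b : U →ₗ[k] V) (j : ℕ) (p : ℕ → U) : Prop where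
  rel : ∀ t, a (p (t + 1)) = b (p t)
  supp : ∀ t, j ≤ t → p t = 0

/-- An *I-chain of length `m`*: a sequence `x : ℕ → U` supported on `t ≤ m` with `a (x 0) = 0` and
`a (x (t+1)) = b (x t)` for all `t` (hence `b (x m) = 0`): a degree-`≤ m` polynomial solution of the pencil's row equation. -/
structure IsChain (a b : U →ₗ[k] V) (m : ℕ) (x : ℕ → U) : Prop where
  head : a (x 0) = 0
  rel : ∀ t, a (x (t + 1)) = b (x t)
  supp : ∀ t, m < t → x t = 0

/-- A Kronecker module is *chain-free* if every I-chain vanishes (no `L_ηᵀ` blocks). -/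
def ChainFree (a b : U →ₗ[k] V) : Prop := ∀ m x, IsChain a b m x → x = 0

variable {a b : U →ₗ[k] V}

namespace IsOpenPath

/-- The zero sequence is an open path. -/
theorem zero (j : ℕ) : IsOpenPath a b j 0 := ⟨fun _ => by simp, fun _ _ => rfl⟩

/-- Open paths of a fixed length are closed under addition. -/
theorem add {j : ℕ} {p q : ℕ → U} (hp : IsOpenPath a b j p) (hq : IsOpenPath a b j q) : IsOpenPath a b j (p + q) :=
  ⟨fun t => by simp [hp.rel t, hq.rel t], fun t ht => by simp [hp.supp t ht, hq.supp t ht]⟩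

/-- Open paths of a fixed length are closed under scalars. -/
theorem smul {j : ℕ} {p : ℕ → U} (hp : IsOpenPath a b j p) (c : k) : IsOpenPath a b j (c • p) :=
  ⟨fun t => by simp [hp.rel t], fun t ht => by simp [hp.supp t ht]⟩

/-- An open path is an open path of any larger length. -/
theorem mono {i j : ℕ} {p : ℕ → U} (hp : IsOpenPath a b i p) (hij : i ≤ j) : IsOpenPath a b j p :=
  ⟨hp.rel, fun t ht => hp.supp t (le_trans hij ht)⟩

/-- The last possibly-nonzero term of an open path lies in `ker b`. -/
theorem b_last {j : ℕ} {p : ℕ → U} (hp : IsOpenPath a b (j + 1) p) : b (p j) = 0 := by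
  rw [← hp.rel j, hp.supp (j + 1) le_rfl, map_zero]

/-- Prepending `u` with `a (p 0) = b u` to an open path gives an open path one longer. -/
theorem prepend {j : ℕ} {p : ℕ → U} (hp : IsOpenPath a b j p) (u : U) (hu : a (p 0) = b u) :
    IsOpenPath a b (j + 1) (prepend u p) := by
  refine ⟨fun t => ?_, fun t ht => ?_⟩
  · cases t with
    | zero => simpa using hu
    | succ t => simpa using hp.rel t
  · cases t with
    | zero => exact absurd ht (by omega)
    | succ t => simpa using hp.supp t (by omega)

/-- A vector of `ker b` is an open path of length `1`. -/
theorem single {u : U} (hu : b u = 0) : IsOpenPath a b 1 (Kronecker.prepend u 0) := by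
  refine ⟨fun t => ?_, fun t ht => ?_⟩
  · cases t with
    | zero => simp [hu]
    | succ t => simp
  · cases t with
    | zero => exact absurd ht (by omega)
    | succ t => simp

end IsOpenPath

namespace IsChain

/-- A chain of length `m` is an open path of length `m + 1` with `a (x 0) = 0`. -/
theorem isOpenPath {m : ℕ} {x : ℕ → U} (hx : IsChain a b m x) : IsOpenPath a b (m + 1) x :=
  ⟨hx.rel, fun t ht => hx.supp t (by omega)⟩

/-- An open path of length `m + 1` with `a (p 0) = 0` is a chain of length `m`. -/
theorem of_isOpenPath {m : ℕ} {x : ℕ → U} (hx : IsOpenPath a b (m + 1) x) (h0 : a (x 0) = 0) : IsChain a b m x :=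
  ⟨h0, hx.rel, fun t ht => hx.supp t (by omega)⟩

/-- The last term of a chain lies in `ker b`. -/
theorem b_last {m : ℕ} {x : ℕ → U} (hx : IsChain a b m x) : b (x m) = 0 := by
  rw [← hx.rel m, hx.supp (m + 1) (Nat.lt_succ_self m), map_zero]

/-- The zero sequence is a chain. -/
theorem zero (m : ℕ) : IsChain a b m 0 := ⟨by simp, fun _ => by simp, fun _ _ => rfl⟩

/-- Chains of a fixed length are closed under addition. -/
theorem add {m : ℕ} {x y : ℕ → U} (hx : IsChain a b m x) (hy : IsChain a b m y) : IsChain a b m (x + y) :=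
  ⟨by simp [hx.head, hy.head], fun t => by simp [hx.rel t, hy.rel t], fun t ht => by simp [hx.supp t ht, hy.supp t ht]⟩

/-- Chains of a fixed length are closed under scalars. -/
theorem smul {m : ℕ} {x : ℕ → U} (hx : IsChain a b m x) (c : k) : IsChain a b m (c • x) :=
  ⟨by simp [hx.head], fun t => by simp [hx.rel t], fun t ht => by simp [hx.supp t ht]⟩

/-- Finite linear combinations of chains of a fixed length are chains. -/
theorem sum {m : ℕ} {ι : Type*} (s : Finset ι) (c : ι → k) (x : ι → ℕ → U) (hx : ∀ i ∈ s, IsChain a b m (x i)) :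
    IsChain a b m (fun t => ∑ i ∈ s, c i • x i t) := by
  classical
  induction s using Finset.induction_on with
  | empty =>
      have h0 : (fun t => ∑ i ∈ (∅ : Finset ι), c i • x i t) = 0 := by funext t; simp
      rw [h0]; exact zero m
  | insert i s hi ih =>
      have h := ((hx i (Finset.mem_insert_self i s)).smul (c i)).add
        (ih (fun i' hi' => hx i' (Finset.mem_insert_of_mem hi')))
      convert h using 1
      funext t
      simp [Finset.sum_insert hi]

/-- A chain is a chain of any larger length. -/
theorem mono {m n : ℕ} {x : ℕ → U} (hx : IsChain a b m x) (hmn : m ≤ n) : IsChain a b n x :=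
  ⟨hx.head, hx.rel, fun t ht => hx.supp t (lt_of_le_of_lt hmn ht)⟩

/-- A chain of length `m + 1` whose top term vanishes is a chain of length `m`. -/
theorem shorten {m : ℕ} {x : ℕ → U} (hx : IsChain a b (m + 1) x) (htop : x (m + 1) = 0) : IsChain a b m x := by
  refine ⟨hx.head, hx.rel, fun t ht => ?_⟩
  rcases Nat.lt_or_ge (m + 1) t with h | h
  · exact hx.supp t h
  · have : t = m + 1 := by omega
    rw [this, htop]

/-- A chain of length `m + 1` whose bottom term vanishes shifts down to a chain of length `m`. -/
theorem shift {m : ℕ} {x : ℕ → U} (hx : IsChain a b (m + 1) x) (hbot : x 0 = 0) : IsChain a b m (fun t => x (t + 1)) :=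
  ⟨by rw [hx.rel 0, hbot, map_zero], fun t => hx.rel (t + 1), fun t ht => hx.supp (t + 1) (by omega)⟩

/-- A nonzero chain has a nonzero term at an index `≤ m`. -/
theorem exists_ne_zero {m : ℕ} {x : ℕ → U} (hx : IsChain a b m x) (h0 : x ≠ 0) : ∃ t ≤ m, x t ≠ 0 := by
  by_contra h
  push Not at h
  apply h0
  funext t
  rcases Nat.lt_or_ge m t with ht | ht
  · exact hx.supp t ht
  · exact h t ht

end IsChain

/-! ## Restriction to an invariant pair of subspaces -/

/-- The restriction of `a` to an invariant pair `(Us, Vs)` of subspaces (`a Us ⊆ Vs`). -/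
def restr (a : U →ₗ[k] V) (Us : Submodule k U) (Vs : Submodule k V) (h : ∀ u ∈ Us, a u ∈ Vs) : Us →ₗ[k] Vs :=
  (a.domRestrict Us).codRestrict Vs (fun u => h u u.2)

/-- The restriction acts as `a`. -/
@[simp] theorem restr_apply (a : U →ₗ[k] V) (Us : Submodule k U) (Vs : Submodule k V) (h : ∀ u ∈ Us, a u ∈ Vs) (u : Us) :
    ((restr a Us Vs h u : Vs) : V) = a u := rfl

/-- A chain of a restriction is a chain of the module (after coercion). -/
theorem IsChain.of_restr {Us : Submodule k U} {Vs : Submodule k V} {ha : ∀ u ∈ Us, a u ∈ Vs} {hb : ∀ u ∈ Us, b u ∈ Vs}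
    {m : ℕ} {x : ℕ → Us} (hx : IsChain (restr a Us Vs ha) (restr b Us Vs hb) m x) :
    IsChain a b m (fun t => (x t : U)) := by
  refine ⟨?_, fun t => ?_, fun t ht => by simp [hx.supp t ht]⟩
  · have h := congrArg (fun v : Vs => (v : V)) hx.head
    simpa using h
  · have h := congrArg (fun v : Vs => (v : V)) (hx.rel t)
    simpa using h

/-- Chain-freeness passes to invariant pairs of subspaces. -/
theorem ChainFree.restr (hF : ChainFree a b) {Us : Submodule k U} {Vs : Submodule k V} (ha : ∀ u ∈ Us, a u ∈ Vs)
    (hb : ∀ u ∈ Us, b u ∈ Vs) : ChainFree (restr a Us Vs ha) (restr b Us Vs hb) := by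
  intro m x hx
  have h := hF m _ hx.of_restr
  funext t
  have ht := congrFun h t
  exact Subtype.ext (by simpa using ht)

/-! ## The dimension count: `finrank V < finrank U` forces a nonzero chain -/

section DimensionCount

variable (a b)

/-- Extension by zero of a `Fin (n+1)`-indexed tuple to a sequence. -/
def extz {n : ℕ} (x : Fin (n + 1) → U) : ℕ → U := fun t => if h : t < n + 1 then x ⟨t, h⟩ else 0

/-- `extz` below the cut-off. -/
theorem extz_of_lt {n : ℕ} (x : Fin (n + 1) → U) {t : ℕ} (h : t < n + 1) : extz x t = x ⟨t, h⟩ := by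
  simp [extz, h]

/-- `extz` above the cut-off. -/
theorem extz_of_le {n : ℕ} (x : Fin (n + 1) → U) {t : ℕ} (h : n + 1 ≤ t) : extz x t = 0 := by
  simp [extz, Nat.not_lt.mpr h]

/-- `extz` is additive. -/
theorem extz_add {n : ℕ} (x y : Fin (n + 1) → U) (t : ℕ) : extz (x + y) t = extz x t + extz y t := by
  unfold extz; split_ifs <;> simp

/-- `extz` is homogeneous. -/
theorem extz_smul {n : ℕ} (c : k) (x : Fin (n + 1) → U) (t : ℕ) : extz (c • x) t = c • extz x t := by
  unfold extz; split_ifs <;> simp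

/-- The *chain map* `Γₙ : U^{n+1} → V^{n+2}`, `x ↦ (a x₀, a x₁ - b x₀, …, a xₙ - b xₙ₋₁, -b xₙ)`; its kernel is the space of
chains of length `n`. -/
def chainMap (n : ℕ) : (Fin (n + 1) → U) →ₗ[k] (Fin (n + 2) → V) where
  toFun x j := a (extz x j) - (if (j : ℕ) = 0 then 0 else b (extz x (j - 1)))
  map_add' x y := by
    funext j
    simp only [extz_add, map_add, Pi.add_apply]
    split_ifs <;> abel
  map_smul' c x := by
    funext j
    simp only [extz_smul, map_smul, Pi.smul_apply, RingHom.id_apply, smul_sub]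
    split_ifs <;> simp

/-- A kernel vector of the chain map, extended by zero, is a chain. -/
theorem isChain_extz_of_chainMap_eq_zero {n : ℕ} {x : Fin (n + 1) → U} (hx : chainMap a b n x = 0) :
    IsChain a b n (extz x) := by
  have hj : ∀ j : Fin (n + 2), a (extz x j) - (if (j : ℕ) = 0 then 0 else b (extz x (j - 1))) = 0 :=
    fun j => congrFun hx j
  refine ⟨?_, fun t => ?_, fun t ht => extz_of_le x (by omega)⟩
  · simpa using hj 0
  · rcases Nat.lt_or_ge t (n + 1) with ht | ht
    · have h := hj ⟨t + 1, by omega⟩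
      simp only [Nat.add_eq_zero_iff, one_ne_zero, and_false, if_false, Nat.add_sub_cancel] at h
      exact sub_eq_zero.mp h
    · rw [extz_of_le x (by omega), extz_of_le x ht, map_zero, map_zero]

/-- **Dimension count.** If `finrank V < finrank U` there is a nonzero chain (of length `finrank V`): the chain map
`U^{m+1} → V^{m+2}` (`m = finrank V`) has a nontrivial kernel since `(m+2)·m < (m+1)² ≤ (m+1)·finrank U`. -/
theorem exists_chain_of_finrank_lt [FiniteDimensional k U] [FiniteDimensional k V] (h : finrank k V < finrank k U) :
    ∃ x, IsChain a b (finrank k V) x ∧ x ≠ 0 := by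
  set m := finrank k V with hm
  have hlt : finrank k (Fin (m + 2) → V) < finrank k (Fin (m + 1) → U) := by
    rw [Module.finrank_pi_fintype, Module.finrank_pi_fintype, Finset.sum_const, Finset.sum_const, Finset.card_univ,
      Finset.card_univ, Fintype.card_fin, Fintype.card_fin, smul_eq_mul, smul_eq_mul, ← hm]
    have h1 : (m + 2) * m < (m + 1) * (m + 1) := by nlinarith
    have h2 : (m + 1) * (m + 1) ≤ (m + 1) * finrank k U := Nat.mul_le_mul_left _ (by omega)
    omega
  have hker := LinearMap.ker_ne_bot_of_finrank_lt (f := chainMap a b m) hlt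
  obtain ⟨x, hx, hx0⟩ := (Submodule.ne_bot_iff _).mp hker
  refine ⟨extz x, isChain_extz_of_chainMap_eq_zero a b hx, fun h0 => hx0 ?_⟩
  funext i
  have := congrFun h0 i
  rwa [extz_of_lt x i.2] at this

variable {a b}

/-- A chain-free module has `finrank U ≤ finrank V`. -/
theorem ChainFree.finrank_le_top [FiniteDimensional k U] [FiniteDimensional k V] (hF : ChainFree a b) :
    finrank k U ≤ finrank k V := by
  by_contra h
  obtain ⟨x, hx, hx0⟩ := exists_chain_of_finrank_lt a b (Nat.lt_of_not_le h)
  exact hx0 (hF _ x hx)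

/-- **Dimension count on an invariant pair**: in a chain-free module, an invariant pair of subspaces `a Us ⊆ Vs`,
`b Us ⊆ Vs` has `finrank Us ≤ finrank Vs`. -/
theorem ChainFree.finrank_le [FiniteDimensional k U] [FiniteDimensional k V] (hF : ChainFree a b)
    {Us : Submodule k U} {Vs : Submodule k V} (ha : ∀ u ∈ Us, a u ∈ Vs) (hb : ∀ u ∈ Us, b u ∈ Vs) :
    finrank k Us ≤ finrank k Vs :=
  (hF.restr ha hb).finrank_le_top

end DimensionCount

/-! ## Minimal chains -/

/-- A module that is not chain-free has a nonzero chain of MINIMAL length. -/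
theorem exists_minimal_chain (h : ¬ ChainFree a b) :
    ∃ η x, IsChain a b η x ∧ x ≠ 0 ∧ ∀ m < η, ∀ y, IsChain a b m y → y = 0 := by
  classical
  have hex : ∃ η, ∃ x, IsChain a b η x ∧ x ≠ 0 := by
    by_contra hne
    push Not at hne
    exact h hne
  refine ⟨Nat.find hex, (Nat.find_spec hex).choose, (Nat.find_spec hex).choose_spec.1,
    (Nat.find_spec hex).choose_spec.2, fun m hm y hy => ?_⟩
  by_contra hy0
  exact Nat.find_min hex hm ⟨y, hy, hy0⟩

/-- The *minimality* predicate: no nonzero chain of length `< η`. -/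
def MinimalAt (a b : U →ₗ[k] V) (η : ℕ) : Prop := ∀ m < η, ∀ y, IsChain a b m y → y = 0

/-- Under minimality at `η`, a nonzero chain of length `η` has nonzero top term. -/
theorem IsChain.top_ne_zero {η : ℕ} {x : ℕ → U} (hx : IsChain a b η x) (hx0 : x ≠ 0) (hmin : MinimalAt a b η) :
    x η ≠ 0 := by
  intro htop
  cases η with
  | zero =>
      obtain ⟨t, ht, hxt⟩ := hx.exists_ne_zero hx0
      obtain rfl : t = 0 := by omega
      exact hxt htop
  | succ η => exact hx0 (hmin η (Nat.lt_succ_self η) x (hx.shorten htop))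

/-- Under minimality at `η`, a nonzero chain of length `η` has nonzero bottom term. -/
theorem IsChain.bot_ne_zero {η : ℕ} {x : ℕ → U} (hx : IsChain a b η x) (hx0 : x ≠ 0) (hmin : MinimalAt a b η) :
    x 0 ≠ 0 := by
  intro hbot
  cases η with
  | zero =>
      obtain ⟨t, ht, hxt⟩ := hx.exists_ne_zero hx0
      obtain rfl : t = 0 := by omega
      exact hxt hbot
  | succ η =>
      have h := hmin η (Nat.lt_succ_self η) _ (hx.shift hbot)
      obtain ⟨t, ht, hxt⟩ := hx.exists_ne_zero hx0
      cases t with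
      | zero => exact hxt hbot
      | succ t => exact hxt (by simpa using congrFun h t)

end Summit.MatrixMultiplication.OmegaCensus.SmallFormats.Kronecker
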